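import Summits.ResolutionOfSingularities.ResolutionOfSingularities.Theorems.PurelyInseparableDim4PhiLinePolygonTransport
import Summits.ResolutionOfSingularities.ResolutionOfSingularities.Theorems.PurelyInseparableDim4PhiLineCoordinateFrame
import Literature.AlgebraicGeometry.Resolution.InitialFormsChangeOfParameters
import Literature.AlgebraicGeometry.Resolution.HironakaDirectrixPolarTame
import HarnessLib

/-!
# (K-Φ2) chain dictionary VIII: FROM A LINEAR FRAME TO COORDINATES — the linear automorphism `σ_A` of `K[x]` and of `𝒪`

Cell `res-dim4-pi` (D-0157 DOOR 2), Φ = β_h line of res-dim4-idea-1 (CARD I-1-8 (C2) «the arrival frame is a label»). To apply the coefficient-level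
lemmas ((K-Φ3) III/VI form lemma and linear re-adaptation; (K-Φ2) VI `coeff_add_single_u2_eq_zero_of_alphaS_pos`) to a residual read in a carried
LINEAR frame `c_A = ((Σ_j A i j x_j)/1)_i` one changes coordinates by the tree's `linSubst K A` (`x_i ↦ Σ_j A i j x_j`, `HironakaDirectrixLinear.lean`,
invertible: `A * B = 1 = B * A`). This file proves (DEF-FREE):

* §1 `constantCoeff_linSubst`, `linSubst_linSubst_of_mul_eq_one` (`σ_A ∘ σ_B = id` when `B * A = 1`), `linSubst_ringEquiv_*` plumbing: the induced ring
  automorphism `ê_A` of `𝒪 = OriginLocalization K 4` (`IsLocalization.ringEquivOfRingEquiv`) with `ê_A (f/1) = (σ_A f)/1` and `ê_A ∘ c₀ = c_A`;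
* §2 **`pts_linearFrame_eq_pts_coordFrame`**: `pts c_A (G/1) μ = pts c₀ ((σ_B G)/1) μ` — the polygon of `G` in the frame `A` IS the polygon of
  `σ_B G` (G «in frame coordinates») in the coordinate frame; likewise `alphaS`/`betaS`/`deltaS` ((K-Φ2) V `pts_ringEquiv`);
* §3 **`finrank_additiveSubspace_linSubst`**: for a form `Φ` of degree `d < p = char K`, `dim A(σ_A Φ) = dim A(Φ)` (`A(Φ) = 𝕎({Φ})` in tame degree,
  `invarianceSpace_singleton_eq_ker_polar_of_totalDegree_lt_char`, and `finrank_invarianceSpace_image_linSubst`).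

[OURS · counted 0 · AI work weaker than expert review.] Nothing here proves K2(p), the β_h line, or resolution of singularities in dimension ≥ 4 /
characteristic p.

Sources: V. Cossart, O. Piltant, J. Algebra 320 (2008), proof of Prop. 4.2 (independence of the regular system of parameters) [`CossartPiltant2008`];
J. Berthomieu, P. Hivert, H. Mourtada (2010) Lemma 3.6 [`BerthomieuHivertMourtada2010`].
-/

set_option linter.dupNamespace false

noncomputable section

namespace Summit.ResolutionOfSingularities.ResolutionOfSingularities.Theorems.PIDim4

namespace PhiLine

open MvPolynomial Finset IsLocalRing
open Literature.AlgebraicGeometry.Resolution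
open Literature.AlgebraicGeometry.Resolution.Hauser2010
open Literature.AlgebraicGeometry.Resolution.WeightedOrder

variable {K : Type} [Field K]

/-! ## §1 `σ_A` on `K[x]` and on `𝒪` -/

/-- `σ_A` preserves the value at the origin. [folklore] -/
theorem constantCoeff_linSubst (A : Matrix (Fin 4) (Fin 4) K) (F : MvPolynomial (Fin 4) K) : constantCoeff (linSubst K A F) = constantCoeff F := by
  induction F using MvPolynomial.induction_on with
  | C a => rw [linSubst, aeval_C, algebraMap_eq]
  | add p q hp hq => rw [map_add, map_add, hp, hq, map_add]
  | mul_X p i hp =>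
    rw [map_mul, map_mul, hp, map_mul, constantCoeff_X, mul_zero, linSubst_X, map_sum]
    rw [Finset.sum_eq_zero fun j _ => by rw [map_mul, constantCoeff_C, constantCoeff_X, mul_zero], mul_zero]

/-- `σ_A (σ_B F) = F` when `B * A = 1`. [cite: CossartPiltant2008, proof of Prop. 4.2] -/
theorem linSubst_linSubst_of_mul_eq_one {A B : Matrix (Fin 4) (Fin 4) K} (hBA : B * A = 1) (F : MvPolynomial (Fin 4) K) :
    linSubst K A (linSubst K B F) = F := by
  rw [← AlgHom.comp_apply, ← linSubst_mul, hBA, linSubst_one, AlgHom.id_apply]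

/-- The algebra AUTOMORPHISM `σ_A` of `K[x]` for invertible `A`. (Term-level: an `AlgEquiv` built from the two substitutions; no new definition.)
[cite: CossartPiltant2008, proof of Prop. 4.2] -/
theorem linSubst_algEquiv_apply {A B : Matrix (Fin 4) (Fin 4) K} (hAB : A * B = 1) (hBA : B * A = 1) (F : MvPolynomial (Fin 4) K) :
    AlgEquiv.ofAlgHom (linSubst K A) (linSubst K B) (by ext i : 1; exact linSubst_linSubst_of_mul_eq_one hBA _)
      (by ext i : 1; exact linSubst_linSubst_of_mul_eq_one hAB _) F = linSubst K A F := rfl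

/-- `σ_A` maps the complement of `𝔪₀` onto itself (as a submonoid map). [folklore] -/
theorem map_primeCompl_linSubst {A B : Matrix (Fin 4) (Fin 4) K} (hAB : A * B = 1) (hBA : B * A = 1) :
    (Literature.AlgebraicGeometry.Resolution.originIdeal K 4).primeCompl.map
        (AlgEquiv.ofAlgHom (linSubst K A) (linSubst K B) (by ext i : 1; exact linSubst_linSubst_of_mul_eq_one hBA _)
          (by ext i : 1; exact linSubst_linSubst_of_mul_eq_one hAB _)).toRingEquiv.toMonoidHom =
      (Literature.AlgebraicGeometry.Resolution.originIdeal K 4).primeCompl := by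
  ext f
  simp only [Submonoid.mem_map, Ideal.mem_primeCompl_iff, Literature.AlgebraicGeometry.Resolution.mem_originIdeal_iff]
  constructor
  · rintro ⟨g, hg, rfl⟩
    change constantCoeff (linSubst K A g) ≠ 0
    rwa [constantCoeff_linSubst]
  · intro hf
    refine ⟨linSubst K B f, ?_, ?_⟩
    · rwa [constantCoeff_linSubst]
    · change linSubst K A (linSubst K B f) = f
      exact linSubst_linSubst_of_mul_eq_one hBA f

/-! ## §2 The polygon in a linear frame is the polygon of the re-coordinatised polynomial in the coordinate frame -/

/-- **`pts c_A (G/1) = pts c₀ ((σ_B G)/1)`**: with `ê_A` the automorphism of `𝒪` induced by `σ_A` (`A B = 1 = B A`), `c_A = ê_A ∘ c₀` and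
`(G/1) = ê_A ((σ_B G)/1)`, so (K-Φ2) V applies. [cite: CossartPiltant2008, proof of Prop. 4.2] -/
theorem pts_linearFrame_eq_pts_coordFrame {A B : Matrix (Fin 4) (Fin 4) K} (hAB : A * B = 1) (hBA : B * A = 1) (G : MvPolynomial (Fin 4) K)
    (μ : ℕ) :
    pts (fun i : Fin (2 + 2) => algebraMap (MvPolynomial (Fin 4) K) (OriginLocalization K 4) (∑ t, C (A i t) * X t))
        (Ideal.span {algebraMap (MvPolynomial (Fin 4) K) (OriginLocalization K 4) G}) μ =
      pts (fun i : Fin (2 + 2) => algebraMap (MvPolynomial (Fin 4) K) (OriginLocalization K 4) (X i))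
        (Ideal.span {algebraMap (MvPolynomial (Fin 4) K) (OriginLocalization K 4) (linSubst K B G)}) μ := by
  set σA := AlgEquiv.ofAlgHom (linSubst K A) (linSubst K B) (by ext i : 1; exact linSubst_linSubst_of_mul_eq_one hBA _)
      (by ext i : 1; exact linSubst_linSubst_of_mul_eq_one hAB _) with hσA
  set e := IsLocalization.ringEquivOfRingEquiv (M := (Literature.AlgebraicGeometry.Resolution.originIdeal K 4).primeCompl)
      (T := (Literature.AlgebraicGeometry.Resolution.originIdeal K 4).primeCompl) (OriginLocalization K 4) (OriginLocalization K 4)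
      σA.toRingEquiv (map_primeCompl_linSubst hAB hBA) with he
  have he_alg : ∀ F : MvPolynomial (Fin 4) K, e (algebraMap _ _ F) = algebraMap _ _ (linSubst K A F) := by
    intro F
    rw [he, IsLocalization.ringEquivOfRingEquiv_eq]
    rfl
  have hc : (fun i : Fin (2 + 2) => algebraMap (MvPolynomial (Fin 4) K) (OriginLocalization K 4) (∑ t, C (A i t) * X t)) =
      e ∘ (fun i : Fin (2 + 2) => algebraMap (MvPolynomial (Fin 4) K) (OriginLocalization K 4) (X i)) := by
    funext i
    rw [Function.comp_apply, he_alg, linSubst_X]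
  have hJ : Ideal.span {algebraMap (MvPolynomial (Fin 4) K) (OriginLocalization K 4) G} =
      (Ideal.span {algebraMap (MvPolynomial (Fin 4) K) (OriginLocalization K 4) (linSubst K B G)}).map (e : _ →+* _) := by
    rw [map_span_singleton_ringEquiv, he_alg, linSubst_linSubst_of_mul_eq_one hBA]
  rw [hc, hJ, pts_ringEquiv]

/-- The same for `αs`. [cite: CossartPiltant2008, proof of Prop. 4.2] -/
theorem alphaS_linearFrame_eq_alphaS_coordFrame {A B : Matrix (Fin 4) (Fin 4) K} (hAB : A * B = 1) (hBA : B * A = 1) (G : MvPolynomial (Fin 4) K)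
    (μ : ℕ) :
    alphaS (fun i : Fin (2 + 2) => algebraMap (MvPolynomial (Fin 4) K) (OriginLocalization K 4) (∑ t, C (A i t) * X t))
        (Ideal.span {algebraMap (MvPolynomial (Fin 4) K) (OriginLocalization K 4) G}) μ =
      alphaS (fun i : Fin (2 + 2) => algebraMap (MvPolynomial (Fin 4) K) (OriginLocalization K 4) (X i))
        (Ideal.span {algebraMap (MvPolynomial (Fin 4) K) (OriginLocalization K 4) (linSubst K B G)}) μ := by
  unfold WeightedOrder.alphaS; rw [pts_linearFrame_eq_pts_coordFrame hAB hBA]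

/-- The same for `βs`. [cite: CossartPiltant2008, proof of Prop. 4.2] -/
theorem betaS_linearFrame_eq_betaS_coordFrame {A B : Matrix (Fin 4) (Fin 4) K} (hAB : A * B = 1) (hBA : B * A = 1) (G : MvPolynomial (Fin 4) K)
    (μ : ℕ) :
    betaS (fun i : Fin (2 + 2) => algebraMap (MvPolynomial (Fin 4) K) (OriginLocalization K 4) (∑ t, C (A i t) * X t))
        (Ideal.span {algebraMap (MvPolynomial (Fin 4) K) (OriginLocalization K 4) G}) μ =
      betaS (fun i : Fin (2 + 2) => algebraMap (MvPolynomial (Fin 4) K) (OriginLocalization K 4) (X i))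
        (Ideal.span {algebraMap (MvPolynomial (Fin 4) K) (OriginLocalization K 4) (linSubst K B G)}) μ := by
  unfold WeightedOrder.betaS; rw [pts_linearFrame_eq_pts_coordFrame hAB hBA, alphaS_linearFrame_eq_alphaS_coordFrame hAB hBA]

/-- The same for `δs`. [cite: CossartPiltant2008, proof of Prop. 4.2] -/
theorem deltaS_linearFrame_eq_deltaS_coordFrame {A B : Matrix (Fin 4) (Fin 4) K} (hAB : A * B = 1) (hBA : B * A = 1) (G : MvPolynomial (Fin 4) K)
    (μ : ℕ) :
    deltaS (fun i : Fin (2 + 2) => algebraMap (MvPolynomial (Fin 4) K) (OriginLocalization K 4) (∑ t, C (A i t) * X t))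
        (Ideal.span {algebraMap (MvPolynomial (Fin 4) K) (OriginLocalization K 4) G}) μ =
      deltaS (fun i : Fin (2 + 2) => algebraMap (MvPolynomial (Fin 4) K) (OriginLocalization K 4) (X i))
        (Ideal.span {algebraMap (MvPolynomial (Fin 4) K) (OriginLocalization K 4) (linSubst K B G)}) μ := by
  unfold WeightedOrder.deltaS; rw [pts_linearFrame_eq_pts_coordFrame hAB hBA]

/-! ## §3 The additive subspace under `σ_A` in tame degree -/

/-- In tame degree (`deg Φ < p`), `A(Φ) = 𝕎({Φ})`. [cite: BerthomieuHivertMourtada2010, Lemma 3.6] -/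
theorem additiveSubspace_eq_invarianceSpace (p : ℕ) [CharP K p] {Φ : MvPolynomial (Fin 4) K} (hΦ : Φ.totalDegree < p) :
    PointBlowup.additiveSubspace Φ = invarianceSpace K ({Φ} : Set (MvPolynomial (Fin 4) K)) := by
  rw [invarianceSpace_singleton_eq_ker_polar_of_totalDegree_lt_char K p Φ hΦ]
  rfl

/-- **`dim A(σ_A Φ) = dim A(Φ)`** for a form `Φ` of degree `d < p` and invertible `A`. [cite: CossartPiltant2008, proof of Prop. 4.2]
[cite: BerthomieuHivertMourtada2010, Lemma 3.6] -/
theorem finrank_additiveSubspace_linSubst (p : ℕ) [CharP K p] {A B : Matrix (Fin 4) (Fin 4) K} (hAB : A * B = 1) (hBA : B * A = 1)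
    {Φ : MvPolynomial (Fin 4) K} {d : ℕ} (hΦ : Φ.IsHomogeneous d) (hdp : d < p) :
    Module.finrank K (PointBlowup.additiveSubspace (linSubst K A Φ)) = Module.finrank K (PointBlowup.additiveSubspace Φ) := by
  have h1 : Φ.totalDegree < p := lt_of_le_of_lt hΦ.totalDegree_le hdp
  have h2 : (linSubst K A Φ).totalDegree < p := lt_of_le_of_lt (isHomogeneous_linSubst A hΦ).totalDegree_le hdp
  rw [additiveSubspace_eq_invarianceSpace p h1, additiveSubspace_eq_invarianceSpace p h2, ← Set.image_singleton,
    finrank_invarianceSpace_image_linSubst K hAB hBA]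

end PhiLine

end Summit.ResolutionOfSingularities.ResolutionOfSingularities.Theorems.PIDim4

end
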